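import Summits.AtomisticToContinuum.BoseEinsteinCondensation.Theorems.BECCellInformationOneBodyEntropyBoundPosCoreCells
import Literature.MathematicalPhysics.QuantumManyBody.JelliumOnsagerBound

/-!
# Crux `OneBodyEntropyBound` (stmt-AtomisticToContinuum-13440), line `registered`: helpers for the lead's stub
# `stub_coarsePosCore` — expectations of cell occupations in the state `|Ψ|² dX`

Support file (`--supports stmt-AtomisticToContinuum-13440`). For a trial state `Ψ ∈ TrialState (n+1) L` and the
half-open cells `Q_k` of side `s` (notation of `…PosCoreCells.lean`: `a_i = 1_Q(X i)`, `N_Q = Σ_i a_i`, `O_Q = Σ_i Σ_{j≠i} a_i a_j`):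
* `setIntegral_oneBody_eq` — the cell mass of the one-body law `P_k = ∫_{Q_k} P¹` is `E[1_{Q_k}(X 0)]`
  (Fubini through `piFinSuccAbove`);
* `integral_num_mul_normSq` — Bose symmetry: `E[N_{Q}] = (n+1) E[1_Q(X 0)]` (`integral_comp_perm`);
* `sq_integral_num_le` — Jensen/variance: `E[N_Q]² ≤ E[N_Q²]`;
* `integral_sum_opairs_le` — the pigeonhole bound integrated: `E[Σ_k O_{Q_k}] ≤ 2·energy/c₁` when `v ≥ c₁` on
  `(0, r₀]` and `3s² ≤ r₀²` (off the null diagonals);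
* `sq_mul_sum_sq_cellMass_le` — together: `(n+1)² Σ_k P_k² ≤ (n+1) + 2·energy/c₁`;
* `klFun_le_sq_sub_one` — `klFun x ≤ (x−1)²`.
`[folklore]` throughout.
-/

noncomputable section

namespace Summit.AtomisticToContinuum.BoseEinsteinCondensation.Cruxes.OneBodyEntropyBound.Birth

open MeasureTheory Set Filter InformationTheory
open scoped ENNReal
open Literature.MathematicalPhysics.QuantumManyBody.BoseGas
open Summit.AtomisticToContinuum.BoseEinsteinCondensation.Theorems

namespace PosCore

/-! ### Relabelling invariance of the Bochner integral -/

/-- Lebesgue measure on `(ℝ³)^N` is invariant under relabelling (Bochner form): `∫ G(X ∘ σ) dX = ∫ G`.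
[folklore] -/
theorem integral_comp_perm {N : ℕ} (σ : Equiv.Perm (Fin N)) (G : Config N → ℝ) :
    ∫ X : Config N, G (X ∘ σ) = ∫ X, G X := by
  have hmp := volume_measurePreserving_piCongrLeft (fun _ : Fin N => Space) σ.symm
  have h : ∀ X : Config N,
      (MeasurableEquiv.piCongrLeft (fun _ : Fin N => Space) σ.symm) X = X ∘ σ := by
    intro X
    funext j
    simp [MeasurableEquiv.piCongrLeft, Equiv.piCongrLeft_apply_eq_cast]
  have := hmp.integral_comp' (f := MeasurableEquiv.piCongrLeft (fun _ : Fin N => Space) σ.symm) G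
  simpa only [h] using this

/-! ### Expectations in the state `|Ψ|² dX` -/

section State

variable {n : ℕ} {L : ℝ}

/-- Measurability of the occupation indicators. [folklore] -/
theorem measurable_occ {N : ℕ} {Q : Set Space} (hQ : MeasurableSet Q) (i : Fin N) :
    Measurable fun X : Config N => Q.indicator (fun _ => (1 : ℝ)) (X i) :=
  (measurable_const.indicator hQ).comp (measurable_pi_apply i)

/-- A bounded measurable observable is integrable against `|Ψ|²`. [folklore] -/
theorem integrable_mul_normSq (Ψ : TrialState (n + 1) L) {g : Config (n + 1) → ℝ} (hg : Measurable g)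
    {C : ℝ} (hC : ∀ X, |g X| ≤ C) : Integrable fun X => g X * ‖Ψ.ψ X‖ ^ 2 :=
  (CoarseChainRule.integrable_normSq Ψ).bdd_mul hg.aestronglyMeasurable
    (ae_of_all _ fun X => by rw [Real.norm_eq_abs]; exact hC X)

/-- `|1_Q(X i)| ≤ 1`. [folklore] -/
theorem abs_occ_le {N : ℕ} (Q : Set Space) (X : Config N) (i : Fin N) : |Q.indicator (fun _ => (1 : ℝ)) (X i)| ≤ 1 := by
  rw [abs_of_nonneg (occ_nonneg Q X i)]; exact occ_le_one Q X i

/-- `|N_Q(X)| ≤ N`. [folklore] -/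
theorem abs_num_le {N : ℕ} (Q : Set Space) (X : Config N) : |(∑ i, Q.indicator (fun _ => (1 : ℝ)) (X i))| ≤ N := by
  rw [abs_of_nonneg (num_nonneg Q X)]
  calc (∑ i, Q.indicator (fun _ => (1 : ℝ)) (X i)) ≤ ∑ _i : Fin N, (1 : ℝ) := Finset.sum_le_sum fun i _ => occ_le_one Q X i
    _ = N := by simp

/-- `|N_Q(X)²| ≤ N²`. [folklore] -/
theorem abs_num_sq_le {N : ℕ} (Q : Set Space) (X : Config N) : |(∑ i, Q.indicator (fun _ => (1 : ℝ)) (X i)) ^ 2| ≤ (N : ℝ) ^ 2 := by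
  rw [abs_of_nonneg (sq_nonneg _)]
  exact pow_le_pow_left₀ (num_nonneg Q X) (le_of_abs_le (abs_num_le Q X)) 2

/-- `O_Q(X) ≤ N²`. [folklore] -/
theorem opairs_le {N : ℕ} (Q : Set Space) (X : Config N) : (∑ i, ∑ j ∈ Finset.univ.filter (· ≠ i), Q.indicator (fun _ => (1 : ℝ)) (X i) * Q.indicator (fun _ => (1 : ℝ)) (X j)) ≤ (N : ℝ) ^ 2 := by
  have h := num_sq Q X
  have h1 : (∑ i, Q.indicator (fun _ => (1 : ℝ)) (X i)) ^ 2 ≤ (N : ℝ) ^ 2 := le_of_abs_le (abs_num_sq_le Q X)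
  linarith [num_nonneg Q X]

/-- `N_Q` is measurable. [folklore] -/
theorem measurable_num {N : ℕ} {Q : Set Space} (hQ : MeasurableSet Q) :
    Measurable fun X : Config N => (∑ i, Q.indicator (fun _ => (1 : ℝ)) (X i)) :=
  Finset.measurable_sum _ fun i _ => measurable_occ hQ i

/-- `O_Q` is measurable. [folklore] -/
theorem measurable_opairs {N : ℕ} {Q : Set Space} (hQ : MeasurableSet Q) :
    Measurable fun X : Config N => (∑ i, ∑ j ∈ Finset.univ.filter (· ≠ i), Q.indicator (fun _ => (1 : ℝ)) (X i) * Q.indicator (fun _ => (1 : ℝ)) (X j)) :=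
  Finset.measurable_sum _ fun i _ => Finset.measurable_sum _ fun j _ =>
    (measurable_occ hQ i).mul (measurable_occ hQ j)

/-- **Cell mass of the one-body law = probability that particle `0` is in the cell.**
`∫_Q P¹ = ∫ 1_Q(X 0) |Ψ(X)|² dX`. [folklore] -/
theorem setIntegral_oneBody_eq (Ψ : TrialState (n + 1) L) {Q : Set Space} (hQ : MeasurableSet Q) :
    ∫ x in Q, ∫ Y : Config n, ‖Ψ.ψ (Matrix.vecCons x Y)‖ ^ 2 =
      ∫ X, Q.indicator (fun _ => (1 : ℝ)) (X 0) * ‖Ψ.ψ X‖ ^ 2 := by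
  set e := MeasurableEquiv.piFinSuccAbove (fun _ : Fin (n + 1) => Space) 0 with he
  have hmp : MeasurePreserving e.symm (volume.prod volume) volume :=
    (volume_preserving_piFinSuccAbove (fun _ : Fin (n + 1) => Space) 0).symm
  have h := hmp.integral_comp' (fun X => Q.indicator (fun _ => (1 : ℝ)) (X 0) * ‖Ψ.ψ X‖ ^ 2)
  simp only [he, piFinSuccAbove_symm_apply_eq_vecCons] at h
  rw [← h]
  have hocc : ∀ p : Space × Config n, Q.indicator (fun _ => (1 : ℝ)) ((Matrix.vecCons p.1 p.2 : Config (n + 1)) 0) =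
      Q.indicator (fun _ => (1 : ℝ)) p.1 := fun p => by simp
  simp only [hocc]
  have hint : Integrable (fun p : Space × Config n =>
      Q.indicator (fun _ => (1 : ℝ)) p.1 * ‖Ψ.ψ (Matrix.vecCons p.1 p.2)‖ ^ 2) (volume.prod volume) :=
    (CoarseChainRule.integrable_normSq_vecCons Ψ).bdd_mul
      ((measurable_const.indicator hQ).comp measurable_fst).aestronglyMeasurable
      (ae_of_all _ fun p => by
        rw [Real.norm_eq_abs, abs_of_nonneg (Set.indicator_nonneg (fun _ _ => zero_le_one) _)]
        exact Set.indicator_le_self' (fun _ _ => zero_le_one) _)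
  rw [integral_prod _ hint, ← integral_indicator hQ]
  refine integral_congr_ae (ae_of_all _ fun x => ?_)
  simp only
  rw [integral_const_mul]
  by_cases hx : x ∈ Q
  · simp [Set.indicator_of_mem hx]
  · simp [Set.indicator_of_notMem hx]

/-- **Bose symmetry**: the probability that particle `i` is in `Q` equals that for particle `0`. [folklore] -/
theorem integral_occ_mul_normSq_eq (Ψ : TrialState (n + 1) L) (Q : Set Space) (i : Fin (n + 1)) :
    ∫ X, Q.indicator (fun _ => (1 : ℝ)) (X i) * ‖Ψ.ψ X‖ ^ 2 = ∫ X, Q.indicator (fun _ => (1 : ℝ)) (X 0) * ‖Ψ.ψ X‖ ^ 2 := by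
  rw [← integral_comp_perm (Equiv.swap 0 i) (fun X => Q.indicator (fun _ => (1 : ℝ)) (X 0) * ‖Ψ.ψ X‖ ^ 2)]
  refine integral_congr_ae (ae_of_all _ fun X => ?_)
  simp only [Function.comp_apply, Equiv.swap_apply_left, Ψ.symm]

/-- **Expected occupation** `n_Q = (n+1) · P(X 0 ∈ Q)`. [folklore] -/
theorem integral_num_mul_normSq (Ψ : TrialState (n + 1) L) {Q : Set Space} (hQ : MeasurableSet Q) :
    ∫ X, (∑ i, Q.indicator (fun _ => (1 : ℝ)) (X i)) * ‖Ψ.ψ X‖ ^ 2 = ((n + 1 : ℕ) : ℝ) * ∫ X, Q.indicator (fun _ => (1 : ℝ)) (X 0) * ‖Ψ.ψ X‖ ^ 2 := by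
  simp_rw [Finset.sum_mul]
  rw [integral_finsetSum _ fun i _ => integrable_mul_normSq Ψ (measurable_occ hQ i) (abs_occ_le Q · i)]
  simp only [integral_occ_mul_normSq_eq Ψ Q, Finset.sum_const, Finset.card_univ, Fintype.card_fin,
    nsmul_eq_mul]

/-- **Jensen / variance**: `(E N_Q)² ≤ E N_Q²` in the state `|Ψ|² dX` (`∫ |Ψ|² = 1`). [folklore] -/
theorem sq_integral_num_le (Ψ : TrialState (n + 1) L) {Q : Set Space} (hQ : MeasurableSet Q) :
    (∫ X, (∑ i, Q.indicator (fun _ => (1 : ℝ)) (X i)) * ‖Ψ.ψ X‖ ^ 2) ^ 2 ≤ ∫ X, (∑ i, Q.indicator (fun _ => (1 : ℝ)) (X i)) ^ 2 * ‖Ψ.ψ X‖ ^ 2 := by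
  set a := ∫ X, (∑ i, Q.indicator (fun _ => (1 : ℝ)) (X i)) * ‖Ψ.ψ X‖ ^ 2 with ha
  have i0 := CoarseChainRule.integrable_normSq Ψ
  have i1 : Integrable fun X => (∑ i, Q.indicator (fun _ => (1 : ℝ)) (X i)) * ‖Ψ.ψ X‖ ^ 2 :=
    integrable_mul_normSq Ψ (measurable_num hQ) (abs_num_le Q)
  have i2 : Integrable fun X => (∑ i, Q.indicator (fun _ => (1 : ℝ)) (X i)) ^ 2 * ‖Ψ.ψ X‖ ^ 2 :=
    integrable_mul_normSq Ψ ((measurable_num hQ).pow_const 2) (abs_num_sq_le Q)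
  have hpos : 0 ≤ ∫ X, ((∑ i, Q.indicator (fun _ => (1 : ℝ)) (X i)) - a) ^ 2 * ‖Ψ.ψ X‖ ^ 2 :=
    integral_nonneg fun X => mul_nonneg (sq_nonneg _) (sq_nonneg _)
  have hexp : ∫ X, ((∑ i, Q.indicator (fun _ => (1 : ℝ)) (X i)) - a) ^ 2 * ‖Ψ.ψ X‖ ^ 2 =
      (∫ X, (∑ i, Q.indicator (fun _ => (1 : ℝ)) (X i)) ^ 2 * ‖Ψ.ψ X‖ ^ 2) - 2 * a * (∫ X, (∑ i, Q.indicator (fun _ => (1 : ℝ)) (X i)) * ‖Ψ.ψ X‖ ^ 2) +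
        a ^ 2 * ∫ X, ‖Ψ.ψ X‖ ^ 2 := by
    have hpt : ∀ X, ((∑ i, Q.indicator (fun _ => (1 : ℝ)) (X i)) - a) ^ 2 * ‖Ψ.ψ X‖ ^ 2 =
        (∑ i, Q.indicator (fun _ => (1 : ℝ)) (X i)) ^ 2 * ‖Ψ.ψ X‖ ^ 2 - 2 * a * ((∑ i, Q.indicator (fun _ => (1 : ℝ)) (X i)) * ‖Ψ.ψ X‖ ^ 2) + a ^ 2 * ‖Ψ.ψ X‖ ^ 2 := by
      intro X; ring
    simp_rw [hpt]
    rw [integral_add (i2.sub' (i1.const_mul _)) (i0.const_mul _), integral_sub i2 (i1.const_mul _),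
      integral_const_mul, integral_const_mul]
  rw [hexp, CoarseChainRule.integral_normSq Ψ, ← ha] at hpos
  nlinarith

/-- **The pigeonhole bound, integrated**: `c₁ · E[Σ_k O_{Q_k}] ≤ 2 · energy`, in the real form
`∫ (Σ_k O_{Q_k}) |Ψ|² ≤ 2 · energy.toReal / c₁.toReal` (for `0 < c₁ < ∞`, `energy < ∞`). [folklore] -/
theorem integral_sum_opairs_le {v : ℝ → ℝ≥0∞} {c₁ : ℝ≥0∞} {r₀ s : ℝ} (hr₀ : 0 ≤ r₀) (hs : 0 < s)
    (hsr : 3 * s ^ 2 ≤ r₀ ^ 2) (hv : ∀ r : ℝ, 0 < r → r ≤ r₀ → c₁ ≤ v r) (hc₁ : c₁ ≠ 0)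
    (hc₁top : c₁ ≠ ⊤) {M : ℕ} (Ψ : TrialState (n + 1) L) (hE : energy v Ψ ≠ ⊤) :
    ∫ X, (∑ k : Fin 3 → Fin M, (∑ i, ∑ j ∈ Finset.univ.filter (· ≠ i), {y : Space | ∀ j, y j ∈ Set.Ico (((k j : ℕ) : ℝ) * s) ((((k j : ℕ) : ℝ) + 1) * s)}.indicator (fun _ => (1 : ℝ)) (X i) * {y : Space | ∀ j, y j ∈ Set.Ico (((k j : ℕ) : ℝ) * s) ((((k j : ℕ) : ℝ) + 1) * s)}.indicator (fun _ => (1 : ℝ)) (X j))) * ‖Ψ.ψ X‖ ^ 2 ≤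
      2 * (energy v Ψ).toReal / c₁.toReal := by
  set F : Config (n + 1) → ℝ := fun X => (∑ k : Fin 3 → Fin M, (∑ i, ∑ j ∈ Finset.univ.filter (· ≠ i), {y : Space | ∀ j, y j ∈ Set.Ico (((k j : ℕ) : ℝ) * s) ((((k j : ℕ) : ℝ) + 1) * s)}.indicator (fun _ => (1 : ℝ)) (X i) * {y : Space | ∀ j, y j ∈ Set.Ico (((k j : ℕ) : ℝ) * s) ((((k j : ℕ) : ℝ) + 1) * s)}.indicator (fun _ => (1 : ℝ)) (X j))) * ‖Ψ.ψ X‖ ^ 2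
    with hFdef
  have hF0 : ∀ X, 0 ≤ F X := fun X =>
    mul_nonneg (Finset.sum_nonneg fun k _ => opairs_nonneg _ X) (sq_nonneg _)
  have hFm : Measurable fun X : Config (n + 1) => ∑ k : Fin 3 → Fin M, (∑ i, ∑ j ∈ Finset.univ.filter (· ≠ i), {y : Space | ∀ j, y j ∈ Set.Ico (((k j : ℕ) : ℝ) * s) ((((k j : ℕ) : ℝ) + 1) * s)}.indicator (fun _ => (1 : ℝ)) (X i) * {y : Space | ∀ j, y j ∈ Set.Ico (((k j : ℕ) : ℝ) * s) ((((k j : ℕ) : ℝ) + 1) * s)}.indicator (fun _ => (1 : ℝ)) (X j)) :=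
    Finset.measurable_sum _ fun k _ => measurable_opairs (CoarseChainRule.measurableSet_cell s k)
  have hFi : Integrable F := by
    refine integrable_mul_normSq Ψ hFm (C := ∑ _k : Fin 3 → Fin M, ((n + 1 : ℕ) : ℝ) ^ 2) fun X => ?_
    rw [abs_of_nonneg (Finset.sum_nonneg fun k _ => opairs_nonneg _ X)]
    exact Finset.sum_le_sum fun k _ => opairs_le _ X
  -- the bound in `[0, ∞]`
  have hpt : ∀ᵐ X : Config (n + 1), c₁ * ENNReal.ofReal (F X) ≤
      2 * (interaction v X * (‖Ψ.ψ X‖₊ : ℝ≥0∞) ^ 2) := by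
    filter_upwards [Literature.MathematicalPhysics.QuantumManyBody.JelliumBoseGas.ae_injective (n + 1)]
      with X hXinj
    have hX : ∀ i j : Fin (n + 1), i ≠ j → X i ≠ X j := fun i j hij h => hij (hXinj h)
    have hw : ENNReal.ofReal (‖Ψ.ψ X‖ ^ 2) = (‖Ψ.ψ X‖₊ : ℝ≥0∞) ^ 2 := by
      rw [ENNReal.ofReal_pow (norm_nonneg _), ofReal_norm, enorm_eq_nnnorm]
    rw [hFdef]
    simp only
    rw [ENNReal.ofReal_mul (Finset.sum_nonneg fun k _ => opairs_nonneg _ X), hw, ← mul_assoc,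
      ← mul_assoc]
    exact mul_le_mul' (sum_opairs_bound hr₀ hs hsr hv X hX) le_rfl
  have key : c₁ * ∫⁻ X, ENNReal.ofReal (F X) ≤ 2 * energy v Ψ := by
    rw [← lintegral_const_mul' _ _ hc₁top]
    calc ∫⁻ X, c₁ * ENNReal.ofReal (F X)
        ≤ ∫⁻ X, 2 * (interaction v X * (‖Ψ.ψ X‖₊ : ℝ≥0∞) ^ 2) := lintegral_mono_ae hpt
      _ = 2 * ∫⁻ X, interaction v X * (‖Ψ.ψ X‖₊ : ℝ≥0∞) ^ 2 := by
          rw [lintegral_const_mul' _ _ ENNReal.ofNat_ne_top]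
      _ ≤ 2 * energy v Ψ := by
          refine mul_le_mul' le_rfl (lintegral_mono fun X => ?_)
          exact le_add_self
  have key' : ∫⁻ X, ENNReal.ofReal (F X) ≤ 2 * energy v Ψ / c₁ := by
    rw [ENNReal.le_div_iff_mul_le (Or.inl hc₁) (Or.inl hc₁top), mul_comm]
    exact key
  have htop : 2 * energy v Ψ / c₁ ≠ ⊤ :=
    ENNReal.div_ne_top (ENNReal.mul_ne_top ENNReal.ofNat_ne_top hE) hc₁
  rw [integral_eq_lintegral_of_nonneg_ae (ae_of_all _ hF0) hFi.aestronglyMeasurable]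
  calc (∫⁻ X, ENNReal.ofReal (F X)).toReal ≤ (2 * energy v Ψ / c₁).toReal :=
        ENNReal.toReal_mono htop key'
    _ = 2 * (energy v Ψ).toReal / c₁.toReal := by
        rw [ENNReal.toReal_div, ENNReal.toReal_mul, ENNReal.toReal_ofNat]

/-- **The occupation bound.** With `P_k = ∫_{Q_k} P¹` the cell masses of the one-body law:
`(n+1)² Σ_k P_k² ≤ (n+1) + 2 · energy.toReal / c₁.toReal`. [folklore] -/
theorem sq_mul_sum_sq_cellMass_le {v : ℝ → ℝ≥0∞} {c₁ : ℝ≥0∞} {r₀ s : ℝ} (hr₀ : 0 ≤ r₀) (hs : 0 < s)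
    (hsr : 3 * s ^ 2 ≤ r₀ ^ 2) (hv : ∀ r : ℝ, 0 < r → r ≤ r₀ → c₁ ≤ v r) (hc₁ : c₁ ≠ 0)
    (hc₁top : c₁ ≠ ⊤) {M : ℕ} (Ψ : TrialState (n + 1) L) (hE : energy v Ψ ≠ ⊤) :
    ((n + 1 : ℕ) : ℝ) ^ 2 * ∑ k : Fin 3 → Fin M,
        (∫ x in {y : Space | ∀ j, y j ∈ Set.Ico (((k j : ℕ) : ℝ) * s) ((((k j : ℕ) : ℝ) + 1) * s)}, ∫ Y : Config n, ‖Ψ.ψ (Matrix.vecCons x Y)‖ ^ 2) ^ 2 ≤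
      ((n + 1 : ℕ) : ℝ) + 2 * (energy v Ψ).toReal / c₁.toReal := by
  have hcm : ∀ k : Fin 3 → Fin M, MeasurableSet {y : Space | ∀ j, y j ∈ Set.Ico (((k j : ℕ) : ℝ) * s) ((((k j : ℕ) : ℝ) + 1) * s)} := fun k => CoarseChainRule.measurableSet_cell s k
  -- `(n+1) P_k = E[N_k]`
  have hnk : ∀ k : Fin 3 → Fin M, ((n + 1 : ℕ) : ℝ) *
      (∫ x in {y : Space | ∀ j, y j ∈ Set.Ico (((k j : ℕ) : ℝ) * s) ((((k j : ℕ) : ℝ) + 1) * s)}, ∫ Y : Config n, ‖Ψ.ψ (Matrix.vecCons x Y)‖ ^ 2) =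
      ∫ X, (∑ i, {y : Space | ∀ j, y j ∈ Set.Ico (((k j : ℕ) : ℝ) * s) ((((k j : ℕ) : ℝ) + 1) * s)}.indicator (fun _ => (1 : ℝ)) (X i)) * ‖Ψ.ψ X‖ ^ 2 := fun k => by
    rw [setIntegral_oneBody_eq Ψ (hcm k), integral_num_mul_normSq Ψ (hcm k)]
  -- integrability
  have i1 : ∀ k : Fin 3 → Fin M, Integrable fun X => (∑ i, {y : Space | ∀ j, y j ∈ Set.Ico (((k j : ℕ) : ℝ) * s) ((((k j : ℕ) : ℝ) + 1) * s)}.indicator (fun _ => (1 : ℝ)) (X i)) * ‖Ψ.ψ X‖ ^ 2 := fun k =>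
    integrable_mul_normSq Ψ (measurable_num (hcm k)) (abs_num_le _)
  have i2 : ∀ k : Fin 3 → Fin M, Integrable fun X => (∑ i, {y : Space | ∀ j, y j ∈ Set.Ico (((k j : ℕ) : ℝ) * s) ((((k j : ℕ) : ℝ) + 1) * s)}.indicator (fun _ => (1 : ℝ)) (X i)) ^ 2 * ‖Ψ.ψ X‖ ^ 2 := fun k =>
    integrable_mul_normSq Ψ ((measurable_num (hcm k)).pow_const 2) (abs_num_sq_le _)
  have i3 : ∀ k : Fin 3 → Fin M, Integrable fun X => (∑ i, ∑ j ∈ Finset.univ.filter (· ≠ i), {y : Space | ∀ j, y j ∈ Set.Ico (((k j : ℕ) : ℝ) * s) ((((k j : ℕ) : ℝ) + 1) * s)}.indicator (fun _ => (1 : ℝ)) (X i) * {y : Space | ∀ j, y j ∈ Set.Ico (((k j : ℕ) : ℝ) * s) ((((k j : ℕ) : ℝ) + 1) * s)}.indicator (fun _ => (1 : ℝ)) (X j)) * ‖Ψ.ψ X‖ ^ 2 := fun k =>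
    integrable_mul_normSq Ψ (measurable_opairs (hcm k)) fun X => by
      rw [abs_of_nonneg (opairs_nonneg _ X)]; exact opairs_le _ X
  calc ((n + 1 : ℕ) : ℝ) ^ 2 * ∑ k : Fin 3 → Fin M,
        (∫ x in {y : Space | ∀ j, y j ∈ Set.Ico (((k j : ℕ) : ℝ) * s) ((((k j : ℕ) : ℝ) + 1) * s)}, ∫ Y : Config n, ‖Ψ.ψ (Matrix.vecCons x Y)‖ ^ 2) ^ 2
      = ∑ k : Fin 3 → Fin M, (∫ X, (∑ i, {y : Space | ∀ j, y j ∈ Set.Ico (((k j : ℕ) : ℝ) * s) ((((k j : ℕ) : ℝ) + 1) * s)}.indicator (fun _ => (1 : ℝ)) (X i)) * ‖Ψ.ψ X‖ ^ 2) ^ 2 := by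
        rw [Finset.mul_sum]
        refine Finset.sum_congr rfl fun k _ => ?_
        rw [← hnk k]; ring
    _ ≤ ∑ k : Fin 3 → Fin M, ∫ X, (∑ i, {y : Space | ∀ j, y j ∈ Set.Ico (((k j : ℕ) : ℝ) * s) ((((k j : ℕ) : ℝ) + 1) * s)}.indicator (fun _ => (1 : ℝ)) (X i)) ^ 2 * ‖Ψ.ψ X‖ ^ 2 :=
        Finset.sum_le_sum fun k _ => sq_integral_num_le Ψ (hcm k)
    _ = ∑ k : Fin 3 → Fin M, ((∫ X, (∑ i, {y : Space | ∀ j, y j ∈ Set.Ico (((k j : ℕ) : ℝ) * s) ((((k j : ℕ) : ℝ) + 1) * s)}.indicator (fun _ => (1 : ℝ)) (X i)) * ‖Ψ.ψ X‖ ^ 2) +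
          ∫ X, (∑ i, ∑ j ∈ Finset.univ.filter (· ≠ i), {y : Space | ∀ j, y j ∈ Set.Ico (((k j : ℕ) : ℝ) * s) ((((k j : ℕ) : ℝ) + 1) * s)}.indicator (fun _ => (1 : ℝ)) (X i) * {y : Space | ∀ j, y j ∈ Set.Ico (((k j : ℕ) : ℝ) * s) ((((k j : ℕ) : ℝ) + 1) * s)}.indicator (fun _ => (1 : ℝ)) (X j)) * ‖Ψ.ψ X‖ ^ 2) := by
        refine Finset.sum_congr rfl fun k _ => ?_
        rw [← integral_add (i1 k) (i3 k)]
        refine integral_congr_ae (ae_of_all _ fun X => ?_)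
        simp only
        rw [num_sq]; ring
    _ = (∫ X, (∑ k : Fin 3 → Fin M, (∑ i, {y : Space | ∀ j, y j ∈ Set.Ico (((k j : ℕ) : ℝ) * s) ((((k j : ℕ) : ℝ) + 1) * s)}.indicator (fun _ => (1 : ℝ)) (X i))) * ‖Ψ.ψ X‖ ^ 2) +
          ∫ X, (∑ k : Fin 3 → Fin M, (∑ i, ∑ j ∈ Finset.univ.filter (· ≠ i), {y : Space | ∀ j, y j ∈ Set.Ico (((k j : ℕ) : ℝ) * s) ((((k j : ℕ) : ℝ) + 1) * s)}.indicator (fun _ => (1 : ℝ)) (X i) * {y : Space | ∀ j, y j ∈ Set.Ico (((k j : ℕ) : ℝ) * s) ((((k j : ℕ) : ℝ) + 1) * s)}.indicator (fun _ => (1 : ℝ)) (X j))) * ‖Ψ.ψ X‖ ^ 2 := by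
        rw [Finset.sum_add_distrib, ← integral_finsetSum _ fun k _ => i1 k,
          ← integral_finsetSum _ fun k _ => i3 k]
        congr 1
        · refine integral_congr_ae (ae_of_all _ fun X => ?_); simp only [Finset.sum_mul]
        · refine integral_congr_ae (ae_of_all _ fun X => ?_); simp only [Finset.sum_mul]
    _ ≤ ((n + 1 : ℕ) : ℝ) + 2 * (energy v Ψ).toReal / c₁.toReal := by
        refine add_le_add ?_ (integral_sum_opairs_le hr₀ hs hsr hv hc₁ hc₁top Ψ hE)
        calc ∫ X, (∑ k : Fin 3 → Fin M, (∑ i, {y : Space | ∀ j, y j ∈ Set.Ico (((k j : ℕ) : ℝ) * s) ((((k j : ℕ) : ℝ) + 1) * s)}.indicator (fun _ => (1 : ℝ)) (X i))) * ‖Ψ.ψ X‖ ^ 2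
            ≤ ∫ X, ((n + 1 : ℕ) : ℝ) * ‖Ψ.ψ X‖ ^ 2 := by
              refine integral_mono ?_ ((CoarseChainRule.integrable_normSq Ψ).const_mul _)
                fun X => mul_le_mul_of_nonneg_right (sum_num_le hs X) (sq_nonneg _)
              have h := integrable_finsetSum (Finset.univ) fun k (_ : k ∈ Finset.univ) => i1 k
              refine h.congr (ae_of_all _ fun X => ?_)
              simp only [Finset.sum_mul]
          _ = ((n + 1 : ℕ) : ℝ) := by rw [integral_const_mul, CoarseChainRule.integral_normSq Ψ, mul_one]

end State

/-! ### Elementary inequalities -/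

/-- `klFun x ≤ (x − 1)²` for `x ≥ 0` (from `log x ≤ x − 1`). [folklore] -/
theorem klFun_le_sq_sub_one {x : ℝ} (hx : 0 ≤ x) : klFun x ≤ (x - 1) ^ 2 := by
  rw [klFun_apply]
  rcases hx.eq_or_lt with h0 | hpos
  · rw [← h0]; simp
  · have h := Real.log_le_sub_one_of_pos hpos
    nlinarith [mul_le_mul_of_nonneg_left h hpos.le]


/-- **Registered helper stub `stub_posCoreOccupationBound`** (= `sq_mul_sum_sq_cellMass_le`, closed form): the
occupation bound `(n+1)² Σ_k P_k² ≤ (n+1) + 2·energy/c₁`. [folklore] -/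
theorem stub_posCoreOccupationBound :
    ∀ (n : ℕ) (L : ℝ) (v : ℝ → ENNReal) (c₁ : ENNReal) (r₀ s : ℝ), 0 ≤ r₀ → 0 < s → 3 * s ^ 2 ≤ r₀ ^ 2 →
      (∀ r : ℝ, 0 < r → r ≤ r₀ → c₁ ≤ v r) → c₁ ≠ 0 → c₁ ≠ ⊤ → ∀ (M : ℕ)
      (Ψ : Literature.MathematicalPhysics.QuantumManyBody.BoseGas.TrialState (n + 1) L),
      Literature.MathematicalPhysics.QuantumManyBody.BoseGas.energy v Ψ ≠ ⊤ →
      ((n + 1 : ℕ) : ℝ) ^ 2 * ∑ k : Fin 3 → Fin M,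
      (∫ x in {y : EuclideanSpace ℝ (Fin 3) | ∀ j, y j ∈ Set.Ico (((k j : ℕ) : ℝ) * s) ((((k j : ℕ) : ℝ) + 1) * s)},
      ∫ Y : Literature.MathematicalPhysics.QuantumManyBody.BoseGas.Config n, ‖Ψ.ψ (Matrix.vecCons x Y)‖ ^ 2) ^ 2 ≤
      ((n + 1 : ℕ) : ℝ) + 2 * (Literature.MathematicalPhysics.QuantumManyBody.BoseGas.energy v Ψ).toReal / c₁.toReal :=
  fun _ _ _ _ _ _ hr₀ hs hsr hv hc₁ hc₁top _ Ψ hE => sq_mul_sum_sq_cellMass_le hr₀ hs hsr hv hc₁ hc₁top Ψ hE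

end PosCore


end Summit.AtomisticToContinuum.BoseEinsteinCondensation.Cruxes.OneBodyEntropyBound.Birth

end
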